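import Literature.Geometry.Riemannian.ColdingMinicozziEntropyLowerBound
import Literature.Geometry.Riemannian.GaussianAreaDistortionUpper
import Literature.Geometry.Riemannian.GaussianAreaEstimates
import Literature.MeasureTheory.Hausdorff.SmoothImageHausdorffFinite
import Mathlib.Analysis.Calculus.InverseFunctionTheorem.FDeriv
import HarnessLib

/-!
# Local graphs over the tangent plane and the uniform small-scale bound for Gaussian areas

A curvature-free route to the uniform small-scale bound used in the proof of Colding–Minicozzi
2012, Lemma 7.7 ("`F_{x₀,t₀}(Σ) ≤ 1 + 2ε` for any `x₀` near `Σ` and any `t₀ ≤ t̄`", obtained there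
from Lemma 7.2 (2)–(3), i.e. using the mean curvature): a closed embedded `C¹` submanifold is
covered by finitely many pieces which are graphs with Lipschitz constant `≤ 1 + ε` over their
tangent planes, whence `F_{x₀,t₀}(Σ) ≤ (1+ε)ⁿ + ε` for ALL centres `x₀` and all small scales `t₀`,
by Lipschitz comparison of Hausdorff measures alone. For
`Σ = f(M)` (compact `M`, boundaryless model of dimension `n`, `f` an injective `C^m` map, `m ≥ 1`,
with injective differential) and `F_{p,t} = gaussianArea n p t` (`ColdingMinicozziEntropy.lean`):

* `exists_graph_tangent_reparam` — a `C¹` germ with injective differential is locally a graph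
  `G` over its tangent space `T` (`π ∘ G = id`, `G` `(1+ε)`-Lipschitz), by the inverse function
  theorem applied to `π ∘ h` for the tangent reparametrisation `h` of
  `ColdingMinicozziEntropyLowerBound.lean`;
* `gaussianArea_graph_le` — a graph piece has `F_{y₀,t} ≤ (1+ε)ⁿ` from EVERY centre `y₀`
  (layer cake; the projection is `1`-Lipschitz; Lipschitz images and `μHE[n]`);
* `exists_forall_gaussianArea_range_le` — **`∃ t₀ > 0, ∀ y₀, ∀ t ∈ (0, t₀], F_{y₀,t}(Σ) ≤ (1+ε)ⁿ + ε`**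
  (finite cover by graph pieces, Lebesgue number, far-part estimate of
  `GaussianAreaEstimates.lean`).

Used in `ColdingMinicozziEntropyAchieved.lean` (Lemma 7.7). Everything is proved; no definitions
and no named facts are introduced.

## References

* T. H. Colding, W. P. Minicozzi II, *Generic mean curvature flow I; generic singularities*,
  Ann. of Math. 175 (2012) 755–833, Lemma 7.2 (3), Lemma 7.7 and its proof. [ColdingMinicozzi2012]
-/

noncomputable section

open Set Function Filter Module Metric
open _root_.MeasureTheory _root_.MeasureTheory.Measure
open scoped ENNReal NNReal Topology Manifold

namespace Literature.Geometry.Riemannian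

/-! ### Graph reparametrisation over the tangent space -/

section Graph

variable {EM : Type*} [NormedAddCommGroup EM] [NormedSpace ℝ EM] [FiniteDimensional ℝ EM]
  {F : Type*} [NormedAddCommGroup F] [InnerProductSpace ℝ F]

/-- **Graph reparametrisation of a `C¹` germ over its tangent space.** Let `g : E → F`
(`dim E = n`, `F` a real inner product space) be strictly differentiable at `u₀` with injective
differential `A`, `U` a neighbourhood of `u₀`, `ε > 0`, and `T = range A` (with the orthogonal
projection `π : F → T`). Then near `g u₀` the image of `g` is a GRAPH over `T`: there are
`c₀ ∈ T`, `r > 0` and `G : T → F` with `G c₀ = g u₀`, `π (G v) = v` on `ball c₀ r`, `G`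
`(1+ε)`-Lipschitz there, `G(ball c₀ r) ⊆ g(U)` and `g(N) ⊆ G(ball c₀ r)` for a neighbourhood `N`
of `u₀`. Construction: with the tangent reparametrisation `h(v) = g(u₀ + e⁻¹ v)` (`dh(0)` the
inclusion), `k = π ∘ h : T → T` has `dk(0) = id`, so it is invertible near `0` (inverse function
theorem, Mathlib's `HasStrictFDerivAt.localInverse`) and `G = h ∘ k⁻¹`. This is the local graph
representation "smooth hypersurfaces are approximated by a hyperplane on small scales" of
Colding–Minicozzi 2012, proof of Lemma 7.2 (3). [cite: ColdingMinicozzi2012, Lemma 7.2] -/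
theorem exists_graph_tangent_reparam {n : ℕ} (hn : finrank ℝ EM = n)
    {g : EM → F} {A : EM →L[ℝ] F} {u₀ : EM} (hg : HasStrictFDerivAt g A u₀) (hA : Injective A)
    {U : Set EM} (hU : U ∈ 𝓝 u₀) {ε : ℝ} (hε : 0 < ε) :
    ∃ (T : Submodule ℝ F) (_ : FiniteDimensional ℝ T) (G : T → F) (c₀ : T) (r : ℝ),
      finrank ℝ T = n ∧ 0 < r ∧ G c₀ = g u₀ ∧
      (∀ v ∈ ball c₀ r, ∀ w ∈ ball c₀ r, ‖G v - G w‖ ≤ (1 + ε) * ‖v - w‖) ∧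
      (∀ v ∈ ball c₀ r, T.orthogonalProjectionOnto (G v) = v) ∧
      G '' ball c₀ r ⊆ g '' U ∧ ∃ N ∈ 𝓝 u₀, g '' N ⊆ G '' ball c₀ r := by
  -- the tangent space `T = range A` and the isomorphism `e : EM ≃ T`
  set T : Submodule ℝ F := LinearMap.range (A : EM →ₗ[ℝ] F) with hT
  set e : EM ≃L[ℝ] T := (LinearEquiv.ofInjective (A : EM →ₗ[ℝ] F) hA).toContinuousLinearEquiv
    with he
  have hTn : finrank ℝ T = n := by
    rw [← hn]
    exact LinearMap.finrank_range_of_inj hA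
  have heA : ∀ v : T, (A (e.symm v) : F) = (v : F) := by
    intro v
    have h1 : ((LinearEquiv.ofInjective (A : EM →ₗ[ℝ] F) hA (e.symm v) : T) : F) = A (e.symm v) :=
      LinearEquiv.ofInjective_apply (f := (A : EM →ₗ[ℝ] F)) (h := hA) (e.symm v)
    rw [← h1]
    exact congrArg Subtype.val (e.apply_symm_apply v)
  -- `hmap v = g (u₀ + e⁻¹ v)` with derivative the inclusion at `0`
  set hmap : T → F := fun v => g (u₀ + e.symm v) with hh
  have h0 : hmap 0 = g u₀ := by simp [hh]
  have hderiv : HasStrictFDerivAt hmap T.subtypeL 0 := by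
    have h1 : HasStrictFDerivAt (fun v : T => u₀ + e.symm v) (e.symm : T →L[ℝ] EM) 0 :=
      ((e.symm : T →L[ℝ] EM).hasStrictFDerivAt).const_add u₀
    have h2 : HasStrictFDerivAt g A (u₀ + e.symm 0) := by simpa using hg
    have h3 := h2.comp (0 : T) h1
    have hAe : A.comp (e.symm : T →L[ℝ] EM) = T.subtypeL := by
      ext v
      exact heA v
    rw [hAe] at h3
    exact h3
  -- `k = π ∘ hmap : T → T` has derivative the identity at `0`; invert it
  set π := T.orthogonalProjectionOnto with hπ
  set k : T → T := fun v => π (hmap v) with hk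
  have hkd : HasStrictFDerivAt k ((ContinuousLinearEquiv.refl ℝ T : T ≃L[ℝ] T) : T →L[ℝ] T) 0 := by
    have h1 := (π.hasStrictFDerivAt (x := hmap 0)).comp (0 : T) hderiv
    have hπi : π.comp T.subtypeL = ((ContinuousLinearEquiv.refl ℝ T : T ≃L[ℝ] T) : T →L[ℝ] T) := by
      ext v
      simp [hπ]
    rw [hπi] at h1
    exact h1
  set kinv := hkd.localInverse k _ 0 with hkinv
  set c₀ : T := k 0 with hc₀
  have hkinv0 : kinv c₀ = 0 := hkd.localInverse_apply_image
  have hkinvd : HasStrictFDerivAt kinv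
      (((ContinuousLinearEquiv.refl ℝ T).symm : T ≃L[ℝ] T) : T →L[ℝ] T) c₀ := hkd.to_localInverse
  have hright : ∀ᶠ w in 𝓝 c₀, k (kinv w) = w := hkd.eventually_right_inverse
  have hleft : ∀ᶠ v in 𝓝 (0 : T), kinv (k v) = v := hkd.eventually_left_inverse
  have hkinvc : ContinuousAt kinv c₀ := hkd.localInverse_continuousAt
  -- the graph map `G = hmap ∘ kinv`
  set G : T → F := fun w => hmap (kinv w) with hG
  have hG0 : G c₀ = g u₀ := by simp only [hG, hkinv0, h0]
  have hGd : HasStrictFDerivAt G T.subtypeL c₀ := by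
    have h1 : HasStrictFDerivAt hmap T.subtypeL (kinv c₀) := by rw [hkinv0]; exact hderiv
    have h2 := h1.comp c₀ hkinvd
    have : T.subtypeL.comp (((ContinuousLinearEquiv.refl ℝ T).symm : T ≃L[ℝ] T) : T →L[ℝ] T) =
        T.subtypeL := by
      ext v
      simp
    rw [this] at h2
    exact h2
  -- neighbourhoods
  obtain ⟨W, hW, hWb⟩ := exists_nhds_norm_sub_sub_le_of_hasStrictFDerivAt hGd hε
  have hcont : Continuous fun v : T => u₀ + e.symm v := by fun_prop
  have hpreU : (fun v : T => u₀ + e.symm v) ⁻¹' U ∈ 𝓝 (0 : T) :=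
    hcont.continuousAt.preimage_mem_nhds (by simpa using hU)
  have hpreU' : kinv ⁻¹' ((fun v : T => u₀ + e.symm v) ⁻¹' U) ∈ 𝓝 c₀ :=
    hkinvc.preimage_mem_nhds (by rw [hkinv0]; exact hpreU)
  obtain ⟨r, hr, hball⟩ := Metric.mem_nhds_iff.1 (inter_mem (inter_mem hW hright) hpreU')
  have hnormL : ∀ v w : T, ‖T.subtypeL (v - w)‖ = ‖v - w‖ := fun v w => by
    rw [Submodule.subtypeL_apply, Submodule.coe_norm]
  refine ⟨T, inferInstance, G, c₀, r, hTn, hr, hG0, ?_, ?_, ?_, ?_⟩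
  · intro v hv w hw
    have h1 := hWb v (hball hv).1.1 w (hball hw).1.1
    calc ‖G v - G w‖
        = ‖(G v - G w - T.subtypeL (v - w)) + T.subtypeL (v - w)‖ := by rw [sub_add_cancel]
      _ ≤ ‖G v - G w - T.subtypeL (v - w)‖ + ‖T.subtypeL (v - w)‖ := norm_add_le _ _
      _ ≤ ε * ‖v - w‖ + ‖v - w‖ := add_le_add h1 (hnormL v w).le
      _ = (1 + ε) * ‖v - w‖ := by ring
  · intro v hv
    exact (hball hv).1.2
  · rintro _ ⟨w, hw, rfl⟩
    exact ⟨u₀ + e.symm (kinv w), (hball hw).2, rfl⟩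
  · -- `N = {u | e (u - u₀) ∈ V₀}` with `V₀` the set where `kinv ∘ k = id` and `k v ∈ ball c₀ r`
    have hkc : ContinuousAt k 0 := hkd.continuousAt
    have hV₀ : {v : T | kinv (k v) = v} ∩ k ⁻¹' ball c₀ r ∈ 𝓝 (0 : T) :=
      inter_mem hleft (hkc.preimage_mem_nhds (ball_mem_nhds _ hr))
    have hcont' : Continuous fun u : EM => e (u - u₀) := by fun_prop
    refine ⟨(fun u : EM => e (u - u₀)) ⁻¹' ({v : T | kinv (k v) = v} ∩ k ⁻¹' ball c₀ r),
      hcont'.continuousAt.preimage_mem_nhds (by simpa using hV₀), ?_⟩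
    rintro _ ⟨u, ⟨hu1, hu2⟩, rfl⟩
    refine ⟨k (e (u - u₀)), hu2, ?_⟩
    show hmap (kinv (k (e (u - u₀)))) = g u
    rw [show kinv (k (e (u - u₀))) = e (u - u₀) from hu1]
    simp only [hh, ContinuousLinearEquiv.symm_apply_apply, add_sub_cancel]

end Graph

/-! ### Gaussian area of a graph piece from an arbitrary centre -/

section GraphBound

variable {F : Type*} [NormedAddCommGroup F] [InnerProductSpace ℝ F] [MeasurableSpace F] [BorelSpace F]

/-- **A graph piece has weighted area at most `(1+ε)ⁿ` times the flat one, from ANY centre.**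
If `G : T → F` is `(1+ε)`-Lipschitz on `ball c₀ r` with `π ∘ G = id` there (`π` the orthogonal
projection onto the finite-dimensional subspace `T`), then for every `y₀ ∈ F` and `t > 0`,
`∫_{G(B)} e^{-‖y-y₀‖²/4t} dμHE[n] ≤ (1+ε)ⁿ ∫_B e^{-‖v-π y₀‖²/4t} dμHE[n]`: layer cake; the
super-level set `B(y₀, R) ∩ G(B)` lies in `G(B ∩ B_T(π y₀, R))` because
`‖v - π y₀‖ = ‖π(G v - y₀)‖ ≤ ‖G v - y₀‖`, and `μHE[n](G(S)) ≤ (1+ε)ⁿ μHE[n](S)`. The point is the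
uniformity in the centre `y₀` (not only `y₀ = G c₀`), as in Colding–Minicozzi's proof of Lemma 7.7.
[cite: ColdingMinicozzi2012, Lemma 7.2] -/
theorem lintegral_gaussianWeight_graph_le {n : ℕ} {T : Submodule ℝ F} [FiniteDimensional ℝ T]
    {G : T → F} {c₀ : T} {ε r : ℝ} (hε : 0 < ε)
    (hlip : ∀ v ∈ ball c₀ r, ∀ w ∈ ball c₀ r, ‖G v - G w‖ ≤ (1 + ε) * ‖v - w‖)
    (hproj : ∀ v ∈ ball c₀ r, T.orthogonalProjectionOnto (G v) = v)
    (y₀ : F) {t : ℝ} (ht : 0 < t) :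
    ∫⁻ y in G '' ball c₀ r, gaussianWeight y₀ t y ∂(μHE[n] : Measure F) ≤
      ENNReal.ofReal ((1 + ε) ^ n) *
        ∫⁻ v in ball c₀ r, gaussianWeight (T.orthogonalProjectionOnto y₀) t v
          ∂(μHE[n] : Measure T) := by
  have ha : 0 < 1 + ε := by linarith
  set S := ball c₀ r with hS
  set π := T.orthogonalProjectionOnto with hπ
  set p₀ : T := π y₀ with hp₀
  have hlevelT : ∀ (p : T) {τ : ℝ}, 0 < τ → ∀ {s : ℝ}, 0 < s →
      {x : T | s < Real.exp (-(‖x - p‖ ^ 2) / (4 * τ))} = ball p (Real.sqrt (4 * τ * -Real.log s)) := by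
    intro p τ hτ s hs
    ext x
    rw [mem_setOf_eq, mem_ball, dist_eq_norm, ← Real.log_lt_iff_lt_exp hs,
      Real.lt_sqrt (norm_nonneg _), lt_div_iff₀ (by positivity : (0 : ℝ) < 4 * τ)]
    constructor <;> intro h <;> nlinarith
  have hlevelF : ∀ (p : F) {τ : ℝ}, 0 < τ → ∀ {s : ℝ}, 0 < s →
      {x : F | s < Real.exp (-(‖x - p‖ ^ 2) / (4 * τ))} = ball p (Real.sqrt (4 * τ * -Real.log s)) := by
    intro p τ hτ s hs
    ext x
    rw [mem_setOf_eq, mem_ball, dist_eq_norm, ← Real.log_lt_iff_lt_exp hs,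
      Real.lt_sqrt (norm_nonneg _), lt_div_iff₀ (by positivity : (0 : ℝ) < 4 * τ)]
    constructor <;> intro h <;> nlinarith
  set μF : Measure F := (μHE[n] : Measure F).restrict (G '' S) with hμF
  set μT : Measure T := (μHE[n] : Measure T).restrict S with hμT
  have hlayF : ∫⁻ y in G '' S, gaussianWeight y₀ t y ∂(μHE[n] : Measure F) =
      ∫⁻ s in Ioi 0, μF {y : F | s < Real.exp (-(‖y - y₀‖ ^ 2) / (4 * t))} :=
    lintegral_eq_lintegral_meas_lt μF (f := fun y : F => Real.exp (-(‖y - y₀‖ ^ 2) / (4 * t)))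
      (Eventually.of_forall fun y => (Real.exp_pos _).le) (by fun_prop)
  have hlayT : ∫⁻ v in S, gaussianWeight p₀ t v ∂(μHE[n] : Measure T) =
      ∫⁻ s in Ioi 0, μT {v : T | s < Real.exp (-(‖v - p₀‖ ^ 2) / (4 * t))} :=
    lintegral_eq_lintegral_meas_lt μT (f := fun v : T => Real.exp (-(‖v - p₀‖ ^ 2) / (4 * t)))
      (Eventually.of_forall fun v => (Real.exp_pos _).le) (by fun_prop)
  have hpt : ∀ s ∈ Ioi (0 : ℝ),
      μF {y : F | s < Real.exp (-(‖y - y₀‖ ^ 2) / (4 * t))} ≤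
        ENNReal.ofReal ((1 + ε) ^ n) * μT {v : T | s < Real.exp (-(‖v - p₀‖ ^ 2) / (4 * t))} := by
    intro s hs
    rw [mem_Ioi] at hs
    set R := Real.sqrt (4 * t * -Real.log s) with hR
    rw [hlevelT p₀ ht hs, hlevelF y₀ ht hs, hμT, hμF, Measure.restrict_apply measurableSet_ball,
      Measure.restrict_apply measurableSet_ball, ← hR]
    -- `ball y₀ R ∩ G '' S ⊆ G '' (ball p₀ R ∩ S)`: the projection is `1`-Lipschitz
    have hsub : ball y₀ R ∩ G '' S ⊆ G '' (ball p₀ R ∩ S) := by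
      rintro _ ⟨hyR, v, hvS, rfl⟩
      refine ⟨v, ⟨?_, hvS⟩, rfl⟩
      rw [mem_ball, dist_eq_norm] at hyR ⊢
      calc ‖v - p₀‖ = ‖π (G v) - π y₀‖ := by rw [hproj v hvS]
        _ = ‖π (G v - y₀)‖ := by rw [map_sub]
        _ ≤ ‖G v - y₀‖ := Submodule.norm_orthogonalProjectionOnto_apply_le T (G v - y₀)
        _ < R := hyR
    refine (measure_mono hsub).trans ?_
    have hlipS : ∀ y ∈ ball p₀ R ∩ S, ∀ z ∈ ball p₀ R ∩ S,
        dist (G y) (G z) ≤ (1 + ε) * dist y z := by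
      intro y hy z hz
      rw [dist_eq_norm, dist_eq_norm]
      exact hlip y hy.2 z hz.2
    exact euclideanHausdorffMeasure_image_le_of_dist_le_mul ha.le hlipS n
  calc ∫⁻ y in G '' S, gaussianWeight y₀ t y ∂(μHE[n] : Measure F)
      = ∫⁻ s in Ioi 0, μF {y : F | s < Real.exp (-(‖y - y₀‖ ^ 2) / (4 * t))} := hlayF
    _ ≤ ∫⁻ s in Ioi 0, ENNReal.ofReal ((1 + ε) ^ n) *
          μT {v : T | s < Real.exp (-(‖v - p₀‖ ^ 2) / (4 * t))} := setLIntegral_mono' measurableSet_Ioi hpt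
    _ = ENNReal.ofReal ((1 + ε) ^ n) *
          ∫⁻ s in Ioi 0, μT {v : T | s < Real.exp (-(‖v - p₀‖ ^ 2) / (4 * t))} := by
        rw [lintegral_const_mul' _ _ ENNReal.ofReal_ne_top]
    _ = ENNReal.ofReal ((1 + ε) ^ n) * ∫⁻ v in S, gaussianWeight p₀ t v ∂(μHE[n] : Measure T) := by
        rw [hlayT]

/-- An `n`-dimensional inner product space has Gaussian area `1` from each of its points at every
scale: `F_{p,t}(V) = 1` (translation of `gaussianArea_zero_univ`; Colding–Minicozzi 2012,
Remark 1.7). [cite: ColdingMinicozzi2012, Remark 1.7] -/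
theorem gaussianArea_univ_eq_one {V : Type*} [NormedAddCommGroup V] [InnerProductSpace ℝ V]
    [FiniteDimensional ℝ V] [MeasurableSpace V] [BorelSpace V] {n : ℕ} (hV : finrank ℝ V = n)
    (p : V) {t : ℝ} (ht : 0 < t) : gaussianArea n p t (univ : Set V) = 1 := by
  have h := gaussianArea_image_isometryEquiv (IsometryEquiv.addRight p) n (0 : V) t univ
  rw [image_univ, EquivLike.range_eq_univ, gaussianArea_zero_univ hV ht] at h
  have hp : (IsometryEquiv.addRight p) (0 : V) = p := by
    show (0 : V) + p = p
    rw [zero_add]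
  rw [hp] at h
  exact h

end GraphBound

section GraphBound2

variable {F : Type*} [NormedAddCommGroup F] [InnerProductSpace ℝ F] [MeasurableSpace F] [BorelSpace F]

/-- **The Gaussian area of a graph piece is at most `(1+ε)ⁿ`, from any centre and at any scale**
(`dim T = n`): `F_{y₀,t}(G(ball c₀ r)) ≤ (1+ε)ⁿ · F^T_{π y₀, t}(ball c₀ r) ≤ (1+ε)ⁿ`.
[cite: ColdingMinicozzi2012, Lemma 7.2] -/
theorem gaussianArea_graph_le {n : ℕ} {T : Submodule ℝ F} [FiniteDimensional ℝ T]
    (hTn : finrank ℝ T = n) {G : T → F} {c₀ : T} {ε r : ℝ} (hε : 0 < ε)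
    (hlip : ∀ v ∈ ball c₀ r, ∀ w ∈ ball c₀ r, ‖G v - G w‖ ≤ (1 + ε) * ‖v - w‖)
    (hproj : ∀ v ∈ ball c₀ r, T.orthogonalProjectionOnto (G v) = v)
    (y₀ : F) {t : ℝ} (ht : 0 < t) :
    gaussianArea n y₀ t (G '' ball c₀ r) ≤ ENNReal.ofReal ((1 + ε) ^ n) := by
  have key := lintegral_gaussianWeight_graph_le (n := n) hε hlip hproj y₀ ht
  have hplane : gaussianArea n (T.orthogonalProjectionOnto y₀) t (ball c₀ r) ≤ 1 := by
    rw [← gaussianArea_univ_eq_one hTn (T.orthogonalProjectionOnto y₀) ht]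
    exact gaussianArea_mono _ _ _ (subset_univ _)
  rw [gaussianArea_eq] at hplane ⊢
  calc gaussianNormalization n t * ∫⁻ y in G '' ball c₀ r, gaussianWeight y₀ t y ∂(μHE[n] : Measure F)
      ≤ gaussianNormalization n t * (ENNReal.ofReal ((1 + ε) ^ n) *
          ∫⁻ v in ball c₀ r, gaussianWeight (T.orthogonalProjectionOnto y₀) t v
            ∂(μHE[n] : Measure T)) := mul_le_mul' le_rfl key
    _ = ENNReal.ofReal ((1 + ε) ^ n) * (gaussianNormalization n t *
          ∫⁻ v in ball c₀ r, gaussianWeight (T.orthogonalProjectionOnto y₀) t v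
            ∂(μHE[n] : Measure T)) := by ring
    _ ≤ ENNReal.ofReal ((1 + ε) ^ n) * 1 := mul_le_mul' le_rfl hplane
    _ = ENNReal.ofReal ((1 + ε) ^ n) := mul_one _

end GraphBound2

/-! ### The uniform small-scale bound -/

section Uniform

variable {EM : Type*} [NormedAddCommGroup EM] [NormedSpace ℝ EM] [FiniteDimensional ℝ EM]
  {H : Type*} [TopologicalSpace H] {I : ModelWithCorners ℝ EM H} [I.Boundaryless]
  {M : Type*} [TopologicalSpace M] [ChartedSpace H M] [CompactSpace M]
  {F : Type*} [NormedAddCommGroup F] [InnerProductSpace ℝ F] [MeasurableSpace F] [BorelSpace F]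

/-- **Uniform small-scale bound for the Gaussian areas of a closed embedded submanifold.** Let
`M` be compact (boundaryless model of dimension `n`), `f : M → F` an injective `C^m` map (`m ≥ 1`)
with everywhere injective differential, and `ε > 0`. Then there is `t₀ > 0` such that
`F_{y₀,t}(f(M)) ≤ (1+ε)ⁿ + ε` for ALL centres `y₀ ∈ F` and all scales `0 < t ≤ t₀`. Proof
(Colding–Minicozzi 2012, proof of Lemma 7.7): cover `Σ = f(M)` by finitely many graph
pieces (`exists_graph_tangent_reparam`; `f` is a closed embedding, so each piece contains
`Σ ∩ W` for an open `W`), take a Lebesgue number `δ` of the cover; if `y₀` is `δ/2`-close to `Σ`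
then `Σ ∩ B_{δ/2}(y₀)` lies in one piece, of Gaussian area `≤ (1+ε)ⁿ` from `y₀`
(`gaussianArea_graph_le`), while `Σ ∖ B_{δ/2}(y₀)` — or all of `Σ` if `y₀` is `δ/2`-far —
contributes `≤ (4πt)^{-n/2} e^{-δ²/16t} μHE[n](Σ) ≤ ε` for small `t`.
[cite: ColdingMinicozzi2012, Lemma 7.7] -/
theorem exists_forall_gaussianArea_range_le {n : ℕ} (hn : finrank ℝ EM = n) {f : M → F}
    {m : WithTop ℕ∞} (hf : ContMDiff I 𝓘(ℝ, F) m f) (hm : 1 ≤ m) (hinj : Injective f)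
    (hd : ∀ x, Injective (mfderiv I 𝓘(ℝ, F) f x)) {ε : ℝ} (hε : 0 < ε) :
    ∃ t₀ : ℝ, 0 < t₀ ∧ ∀ (y₀ : F) (t : ℝ), 0 < t → t ≤ t₀ →
      gaussianArea n y₀ t (range f) ≤ ENNReal.ofReal ((1 + ε) ^ n) + ENNReal.ofReal ε := by
  have hK : IsCompact (range f) := isCompact_range hf.continuous
  have hΛ : (μHE[n] : Measure F) (range f) < ∞ :=
    MeasureTheory.Hausdorff.euclideanHausdorffMeasure_range_lt_top hf hm (hn ▸ le_rfl)
  have hemb : Topology.IsClosedEmbedding f := hf.continuous.isClosedEmbedding hinj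
  -- graph pieces around every point, and open sets `W x ∋ f x` with `range f ∩ W x ⊆` the piece
  have hpiece : ∀ x : M, ∃ (W : Set F), IsOpen W ∧ f x ∈ W ∧ ∀ (y₀ : F) (t : ℝ), 0 < t →
      gaussianArea n y₀ t (range f ∩ W) ≤ ENNReal.ofReal ((1 + ε) ^ n) := by
    intro x
    set φ := extChartAt I x with hφ
    set g : EM → F := f ∘ φ.symm with hg
    have hfx : ContMDiffAt I 𝓘(ℝ, F) 1 f x := (hf.of_le hm).contMDiffAt
    have hgd : ContDiffAt ℝ 1 g (φ x) := by
      have h := (contMDiffAt_iff.1 hfx).2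
      rw [I.range_eq_univ, contDiffWithinAt_univ] at h
      exact h
    have hmd : MDifferentiableAt I 𝓘(ℝ, F) f x := hfx.mdifferentiableAt one_ne_zero
    have hinj' : Injective (fderiv ℝ g (φ x)) := by
      have h := hd x
      rw [hmd.mfderiv, I.range_eq_univ, fderivWithin_univ] at h
      exact h
    obtain ⟨T, hTfd, G, c₀, r, hTn, hr, -, hlip, hproj, -, N, hN, hgN⟩ :=
      exists_graph_tangent_reparam hn (hgd.hasStrictFDerivAt one_ne_zero) hinj' univ_mem hε
    haveI := hTfd
    -- `f(V) ⊆ G(ball)` for `V = φ.source ∩ φ⁻¹ N`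
    set V : Set M := φ.source ∩ φ ⁻¹' N with hV
    have hVn : V ∈ 𝓝 x :=
      inter_mem (extChartAt_source_mem_nhds (I := I) x)
        ((continuousAt_extChartAt (I := I) x).preimage_mem_nhds hN)
    have hfV : f '' V ⊆ G '' ball c₀ r := by
      rintro _ ⟨z, ⟨hzs, hzN⟩, rfl⟩
      have : f z = g (φ z) := by
        simp only [hg, Function.comp_apply, φ.left_inv hzs]
      rw [this]
      exact hgN ⟨φ z, hzN, rfl⟩
    -- an open `W ∋ f x` with `range f ∩ W ⊆ f '' V`
    have hV' : V ∈ comap f (𝓝 (f x)) := by rwa [← hemb.isInducing.nhds_eq_comap]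
    obtain ⟨W₀, hW₀, hW₀V⟩ := hV'
    obtain ⟨W, hWW₀, hWo, hxW⟩ := _root_.mem_nhds_iff.1 hW₀
    refine ⟨W, hWo, hxW, fun y₀ t ht => ?_⟩
    have hsub : range f ∩ W ⊆ G '' ball c₀ r := by
      rintro _ ⟨⟨z, rfl⟩, hzW⟩
      exact hfV ⟨z, hW₀V (hWW₀ hzW), rfl⟩
    exact (gaussianArea_mono _ _ _ hsub).trans (gaussianArea_graph_le hTn hε hlip hproj y₀ ht)
  choose W hWo hxW hWb using hpiece
  -- Lebesgue number of the cover `{W x}` of `range f`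
  obtain ⟨δ, hδ, hleb⟩ := lebesgue_number_lemma_of_metric hK hWo (by
    rintro _ ⟨x, rfl⟩
    exact mem_iUnion.2 ⟨x, hxW x⟩)
  -- small scales: the far factor at distance `δ/2` is eventually `≤ ε / (Λ + 1)`-ish; we simply require `far * Λ ≤ ofReal ε`
  have hfarlim : Tendsto (fun s : ℝ => ENNReal.ofReal ((4 * Real.pi * s) ^ (-(n : ℝ) / 2) *
      Real.exp (-(δ / 2) ^ 2 / (4 * s))) * (μHE[n] : Measure F) (range f)) (𝓝[>] 0) (𝓝 0) := by
    have h1 := (ENNReal.tendsto_ofReal (tendsto_farFactor n (half_pos hδ)))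
    rw [ENNReal.ofReal_zero] at h1
    have h2 := ENNReal.Tendsto.mul_const h1 (Or.inr hΛ.ne)
    rwa [zero_mul] at h2
  have hεpos : (0 : ℝ≥0∞) < ENNReal.ofReal ε := ENNReal.ofReal_pos.2 hε
  have hfar_ev : ∀ᶠ s : ℝ in 𝓝[>] 0, ENNReal.ofReal ((4 * Real.pi * s) ^ (-(n : ℝ) / 2) *
      Real.exp (-(δ / 2) ^ 2 / (4 * s))) * (μHE[n] : Measure F) (range f) < ENNReal.ofReal ε :=
    (tendsto_order.1 hfarlim).2 _ hεpos
  -- monotonicity of the far factor is not available directly; instead extract `t₀` such that the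
  -- bound holds on the whole interval `(0, t₀]` using the explicit estimate at each `t`:
  -- we use that `hfar_ev` gives a set in `𝓝[>] 0`, which contains an interval `(0, t₀)`.
  obtain ⟨t₁, ht₁, hI⟩ : ∃ t₁ : ℝ, 0 < t₁ ∧ ∀ s : ℝ, 0 < s → s < t₁ →
      ENNReal.ofReal ((4 * Real.pi * s) ^ (-(n : ℝ) / 2) * Real.exp (-(δ / 2) ^ 2 / (4 * s))) *
        (μHE[n] : Measure F) (range f) < ENNReal.ofReal ε := by
    obtain ⟨u, hu, huI⟩ := mem_nhdsGT_iff_exists_Ioo_subset.1 hfar_ev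
    exact ⟨u, hu, fun s hs hsu => huI ⟨hs, hsu⟩⟩
  refine ⟨t₁ / 2, half_pos ht₁, fun y₀ t ht htt => ?_⟩
  have htt₁ : t < t₁ := by linarith
  have hfar_t := hI t ht htt₁
  -- split according to the distance from `y₀` to `range f`
  by_cases hnear : ∃ y ∈ range f, ‖y - y₀‖ < δ / 2
  · obtain ⟨y, hy, hyy₀⟩ := hnear
    obtain ⟨x, hx⟩ := hleb y hy
    -- `range f ∩ ball y₀ (δ/2) ⊆ range f ∩ W x`
    have hballW : ball y₀ (δ / 2) ⊆ W x := by
      intro z hz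
      apply hx
      rw [mem_ball, dist_eq_norm] at hz ⊢
      calc ‖z - y‖ = ‖(z - y₀) - (y - y₀)‖ := by rw [sub_sub_sub_cancel_right]
        _ ≤ ‖z - y₀‖ + ‖y - y₀‖ := norm_sub_le _ _
        _ < δ / 2 + δ / 2 := add_lt_add hz hyy₀
        _ = δ := by ring
    have hsplit : range f = (range f ∩ ball y₀ (δ / 2)) ∪ (range f \ ball y₀ (δ / 2)) := by
      ext z
      constructor
      · intro hz
        by_cases hzb : z ∈ ball y₀ (δ / 2)
        exacts [Or.inl ⟨hz, hzb⟩, Or.inr ⟨hz, hzb⟩]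
      · rintro (⟨hz, -⟩ | ⟨hz, -⟩) <;> exact hz
    have hsubW : range f ∩ ball y₀ (δ / 2) ⊆ range f ∩ W x := fun z hz => ⟨hz.1, hballW hz.2⟩
    have hnearb : gaussianArea n y₀ t (range f ∩ ball y₀ (δ / 2)) ≤ ENNReal.ofReal ((1 + ε) ^ n) :=
      (gaussianArea_mono _ _ _ hsubW).trans (hWb x y₀ t ht)
    have hfarb : gaussianArea n y₀ t (range f \ ball y₀ (δ / 2)) ≤
        ENNReal.ofReal ((4 * Real.pi * t) ^ (-(n : ℝ) / 2) * Real.exp (-(δ / 2) ^ 2 / (4 * t))) *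
          (μHE[n] : Measure F) (range f) := by
      refine (gaussianArea_le_of_le_norm_sub n y₀ ht
        (hK.isClosed.measurableSet.diff measurableSet_ball) (half_pos hδ).le ?_).trans
        (mul_le_mul' le_rfl (measure_mono fun z hz => hz.1))
      rintro z ⟨-, hzb⟩
      rw [mem_ball_iff_norm, not_lt] at hzb
      exact hzb
    calc gaussianArea n y₀ t (range f)
        = gaussianArea n y₀ t ((range f ∩ ball y₀ (δ / 2)) ∪ (range f \ ball y₀ (δ / 2))) := by
          rw [← hsplit]
      _ ≤ gaussianArea n y₀ t (range f ∩ ball y₀ (δ / 2)) +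
          gaussianArea n y₀ t (range f \ ball y₀ (δ / 2)) := gaussianArea_union_le _ _ _ _ _
      _ ≤ ENNReal.ofReal ((1 + ε) ^ n) + ENNReal.ofReal ε := add_le_add hnearb (hfarb.trans hfar_t.le)
  · -- all of `range f` is at distance `≥ δ/2` from `y₀`
    push Not at hnear
    have hfarb : gaussianArea n y₀ t (range f) ≤
        ENNReal.ofReal ((4 * Real.pi * t) ^ (-(n : ℝ) / 2) * Real.exp (-(δ / 2) ^ 2 / (4 * t))) *
          (μHE[n] : Measure F) (range f) :=
      gaussianArea_le_of_le_norm_sub n y₀ ht hK.isClosed.measurableSet (half_pos hδ).le hnear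
    calc gaussianArea n y₀ t (range f) ≤ ENNReal.ofReal ε := hfarb.trans hfar_t.le
      _ ≤ ENNReal.ofReal ((1 + ε) ^ n) + ENNReal.ofReal ε := le_add_self

end Uniform

end Literature.Geometry.Riemannian

end
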